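import Literature.NumberTheory.Sieve.RoughCellDensity
import Literature.NumberTheory.Sieve.BuchstabLimitFact
import Summits.Parity.GeneralizedHardyLittlewood.Theorems.LeeYangFibresModelCellFactsParityPoint
import HarnessLib

/-!
# Route `RoughParitySectors`, crux `OddSectorShareNonlinear` (stmt-Parity-15628), line `birth`:
# the registered stub `stub_oddBuchstabMass` — the odd Buchstab mass is half

`--supports` file of the checked skeleton
`Summits/Parity/BatemanHorn/Cruxes/OddSectorShareNonlinear/Lines/birth.lean`
(crux `Summit.Parity.BatemanHorn.Theses.RoughParitySectors.OddSectorShareNonlinear`). It PROVES the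
registered stub `stub_oddBuchstabMass` verbatim: with Buchstab–Alladi's cell densities
`I_j = Literature.NumberTheory.Sieve.roughCellDensity j` (`I_0 = 0`, `I_1 = 1` on `[1, ∞)`,
`I_{j+2}(u) = ∫_1^{u-1} I_{j+1}(t) dt/t`), the ODD BUCHSTAB MASS
`T(U) = Σ_{j odd, j ≤ ⌊U⌋} I_j(U)` satisfies `T(U) / (U e^{-γ}/2) → 1` as `U → ∞`.

## The argument (pure calculus; every ingredient is a theorem of the tree)

1. TOTAL MASS (Buchstab, Montgomery–Vaughan (7.39)): `Σ_{j ≤ ⌊U⌋} I_j(U) = U ω(U)` for `U ≥ 1`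
   (`sum_roughCellDensity_eq_mul_buchstabOmega` with `N = ⌊U⌋ - 1`, valid as `U ≤ ⌊U⌋ + 1`;
   `oddMass_sum_range_floor_eq`).
2. ALTERNATING MASS (Alladi's parity balance, limit form): `|Σ_{j ≤ ⌊U⌋} (-1)^j I_j(U)| ≤ 1` for
   `U ≥ 2`. The GHL side proved `‖G_M(τ;-1)‖ ≤ 1` on `[1, M+1]` for the model family
   `G_M(τ;z) = Σ_{i<M} cellDensity i τ · z^i` (`ModelCellFacts.norm_modelEval_neg_one_le_one`); the
   bridge `cellDensity i u = I_{i+1}(u)` for `u ≥ 1` (`oddMass_cellDensity_eq_roughCellDensity_succ`,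
   induction on `i`: the two recursions agree on `[1, ∞)`) identifies the alternating mass with
   `-G_{⌊U⌋}(U;-1)` (`oddMass_alternating_eq_neg_modelEval`, `oddMass_abs_alternating_le_one`).
3. ODD = (TOTAL − ALTERNATING)/2 (`oddMass_sum_filter_odd_eq`), so for `U ≥ 2`
   `T(U)/(U e^{-γ}/2) = ω(U)/e^{-γ} − Alt(U)/(U e^{-γ})`; the first term tends to `1` by
   `ω(U) → e^{-γ}` (de Bruijn; `harman2007_buchstabOmega_tendsto_holds`), the second to `0`.

References: H. L. Montgomery, R. C. Vaughan, *Multiplicative Number Theory I*, §7.2 (7.39)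
[MontgomeryVaughan2007]; K. Alladi, Quart. J. Math. Oxford (2) 33 (1982) 129–148 [Alladi1982];
G. Harman, *Prime-Detecting Sieves*, §1.4 and Appendix A.2 [Harman2007]. No definition and no new
fact is introduced.
-/

noncomputable section

open Filter
open Literature.NumberTheory.Sieve
open Summit.Parity.GeneralizedHardyLittlewood.Cruxes.ModelHyperbolicity.WindowChainTransport
open Summit.Parity.GeneralizedHardyLittlewood.Theorems.ModelCellFacts

namespace Summit.Parity.BatemanHorn.Cruxes.OddSectorShareNonlinear.Birth

/-! ## Helper lemmas (tag `oddMass_`) -/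

/-- **Bridge between the two cell-density recursions.** The GHL-side `cellDensity i u`
(`I_1 ≡ 1`, `I_{i+2}(u) = ∫_1^{max(u-1,1)} I_{i+1}(t) dt/t`) and the Literature-side
`roughCellDensity (i+1) u` (`I_1(u) = [1 ≤ u]`, `I_{i+2}(u) = ∫_1^{u-1} I_{i+1}(t) dt/t`) agree for
`u ≥ 1`: by induction on `i`; for `u ≥ 2` both integrate the same function over `[1, u-1]`, for
`1 ≤ u < 2` both vanish. [folklore] -/
theorem oddMass_cellDensity_eq_roughCellDensity_succ :
    ∀ (i : ℕ) {u : ℝ}, 1 ≤ u → cellDensity i u = roughCellDensity (i + 1) u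
  | 0, _, hu => by rw [cellDensity_zero, roughCellDensity_one_of_one_le hu]
  | i + 1, u, hu => by
    rw [calc_cellDensity_succ, roughCellDensity_succ (j := i + 1) (by omega) u]
    rcases le_or_gt 2 u with h2 | h2
    · rw [max_eq_left (by linarith)]
      refine intervalIntegral.integral_congr fun t ht => ?_
      rw [Set.uIcc_of_le (by linarith)] at ht
      show cellDensity i t / t = roughCellDensity (i + 1) t / t
      rw [oddMass_cellDensity_eq_roughCellDensity_succ i ht.1]
    · rw [max_eq_right (by linarith), intervalIntegral.integral_same,
        ← roughCellDensity_succ (j := i + 1) (by omega) u]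
      have hi : (0 : ℝ) ≤ i := Nat.cast_nonneg i
      exact (roughCellDensity_of_lt (i + 1 + 1) (by push_cast; linarith)).symm

/-- **Total mass** (Buchstab's identity, term by term): `Σ_{j ≤ ⌊U⌋} I_j(U) = U ω(U)` for
`U ≥ 1` (the cell `j = 0` is empty, and `U ≤ (⌊U⌋ - 1) + 2`).
[cite: MontgomeryVaughan2007, §7.2 (7.39)] -/
theorem oddMass_sum_range_floor_eq {U : ℝ} (hU : 1 ≤ U) :
    ∑ j ∈ Finset.range (⌊U⌋₊ + 1), roughCellDensity j U = U * buchstabOmega U := by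
  have h1 : 1 ≤ ⌊U⌋₊ := Nat.le_floor (by exact_mod_cast hU)
  obtain ⟨M, hM⟩ : ∃ M, ⌊U⌋₊ = M + 1 := ⟨⌊U⌋₊ - 1, by omega⟩
  have hlt := Nat.lt_floor_add_one U
  rw [hM] at hlt ⊢
  push_cast at hlt
  rw [Finset.sum_range_succ', roughCellDensity_zero, add_zero]
  exact sum_roughCellDensity_eq_mul_buchstabOmega M hU (by linarith)

/-- **The alternating mass is minus the parity point of the model family**:
`Σ_{j ≤ ⌊U⌋} (-1)^j I_j(U) = -G_{⌊U⌋}(U;-1)` for `U ≥ 1` (drop the empty cell `j = 0`, shift the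
index and use the bridge). [folklore] -/
theorem oddMass_alternating_eq_neg_modelEval {U : ℝ} (hU : 1 ≤ U) :
    ((∑ j ∈ Finset.range (⌊U⌋₊ + 1), (-1 : ℝ) ^ j * roughCellDensity j U : ℝ) : ℂ) =
      -modelEval ⌊U⌋₊ U (-1) := by
  rw [modelEval, Finset.sum_range_succ', roughCellDensity_zero, mul_zero, add_zero,
    ← Finset.sum_neg_distrib]
  push_cast
  refine Finset.sum_congr rfl fun i _ => ?_
  rw [oddMass_cellDensity_eq_roughCellDensity_succ i hU]
  ring

/-- **Alladi's parity balance, limit form**: `|Σ_{j ≤ ⌊U⌋} (-1)^j I_j(U)| ≤ 1` for `U ≥ 2`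
(`‖G_M(U;-1)‖ ≤ 1` on `[1, M+1]` with `M = ⌊U⌋ ≥ 2`, `ModelCellFacts.norm_modelEval_neg_one_le_one`).
[cite: Alladi1982, Theorem 1 (limit form)] -/
theorem oddMass_abs_alternating_le_one {U : ℝ} (hU : 2 ≤ U) :
    |∑ j ∈ Finset.range (⌊U⌋₊ + 1), (-1 : ℝ) ^ j * roughCellDensity j U| ≤ 1 := by
  have hU1 : (1 : ℝ) ≤ U := by linarith
  have hN2 : 2 ≤ ⌊U⌋₊ := Nat.le_floor (by exact_mod_cast hU)
  have hUN : U ≤ (⌊U⌋₊ : ℝ) + 1 := (Nat.lt_floor_add_one U).le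
  have h := norm_modelEval_neg_one_le_one hN2 hU1 hUN
  rw [← norm_neg, ← oddMass_alternating_eq_neg_modelEval hU1, Complex.norm_real,
    Real.norm_eq_abs] at h
  exact h

/-- **Odd = (total − alternating)/2**: `Σ_{j ∈ s, j odd} f j = (Σ_{j ∈ s} f j − Σ_{j ∈ s} (-1)^j f j)/2`.
[folklore] -/
theorem oddMass_sum_filter_odd_eq (s : Finset ℕ) (f : ℕ → ℝ) :
    ∑ j ∈ s.filter Odd, f j = ((∑ j ∈ s, f j) - ∑ j ∈ s, (-1 : ℝ) ^ j * f j) / 2 := by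
  rw [Finset.sum_filter, eq_div_iff two_ne_zero, ← Finset.sum_sub_distrib, Finset.sum_mul]
  refine Finset.sum_congr rfl fun j _ => ?_
  rcases Nat.even_or_odd j with hj | hj
  · rw [if_neg (Nat.not_odd_iff_even.mpr hj), hj.neg_one_pow]
    ring
  · rw [if_pos hj, hj.neg_one_pow]
    ring

/-! ## The registered stub -/

/-- **stub_oddBuchstabMass** (registered stub M of the skeleton
`Cruxes/OddSectorShareNonlinear/Lines/birth.lean`, crux stmt-Parity-15628; EXPANDED signature,
definitionally `Sig.stub_oddBuchstabMass`). **The odd Buchstab mass is half:**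
`Σ_{j odd, j ≤ ⌊U⌋} I_j(U) ∼ U e^{-γ}/2` as `U → ∞`, `I_j = roughCellDensity j`. Proof: for
`U ≥ 2` the quotient equals `ω(U)/e^{-γ} − Alt(U)/(U e^{-γ})` with
`Σ_{j ≤ ⌊U⌋} I_j(U) = U ω(U)` (Buchstab, `oddMass_sum_range_floor_eq`) and
`|Alt(U)| = |Σ_{j ≤ ⌊U⌋} (-1)^j I_j(U)| ≤ 1` (Alladi's parity balance,
`oddMass_abs_alternating_le_one`); `ω(U) → e^{-γ}` (`harman2007_buchstabOmega_tendsto_holds`).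
[cite: MontgomeryVaughan2007, §7.2 (7.39)] -/
theorem stub_oddBuchstabMass :
    Tendsto (fun U : ℝ => (∑ j ∈ (Finset.range (⌊U⌋₊ + 1)).filter Odd, roughCellDensity j U) /
      (U * Real.exp (-Real.eulerMascheroniConstant) / 2)) atTop (nhds 1) := by
  set e : ℝ := Real.exp (-Real.eulerMascheroniConstant) with he_def
  have he : 0 < e := Real.exp_pos _
  -- `ω(U)/e^{-γ} → 1`
  have h1 : Tendsto (fun U : ℝ => buchstabOmega U / e) atTop (nhds 1) := by
    have h := harman2007_buchstabOmega_tendsto_holds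
    unfold harman2007_buchstabOmega_tendsto at h
    have h' := h.div_const e
    rwa [div_self he.ne'] at h'
  -- `Alt(U)/(U e^{-γ}) → 0`
  have h2 : Tendsto (fun U : ℝ =>
      (∑ j ∈ Finset.range (⌊U⌋₊ + 1), (-1 : ℝ) ^ j * roughCellDensity j U) / (U * e))
      atTop (nhds 0) := by
    have h0 : Tendsto (fun U : ℝ => 1 / (U * e)) atTop (nhds 0) :=
      tendsto_const_nhds.div_atTop (tendsto_id.atTop_mul_const he)
    refine squeeze_zero_norm' ?_ h0
    filter_upwards [eventually_ge_atTop (2 : ℝ)] with U hU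
    have hUe : 0 < U * e := mul_pos (by linarith) he
    rw [Real.norm_eq_abs, abs_div, abs_of_pos hUe]
    exact div_le_div_of_nonneg_right (oddMass_abs_alternating_le_one hU) hUe.le
  have h3 := h1.sub h2
  rw [sub_zero] at h3
  refine h3.congr' ?_
  filter_upwards [eventually_ge_atTop (2 : ℝ)] with U hU
  have hU0 : U ≠ 0 := ne_of_gt (by linarith)
  rw [oddMass_sum_filter_odd_eq, oddMass_sum_range_floor_eq (by linarith)]
  field_simp

end Summit.Parity.BatemanHorn.Cruxes.OddSectorShareNonlinear.Birth

end
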